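import Summits.AtomisticToContinuum.BoseEinsteinCondensation.Theorems.BECStronglyRayleighLatticeToPeriodicBridgeMuffinTinDefs
import Summits.AtomisticToContinuum.BoseEinsteinCondensation.Theorems.BECStronglyRayleighLatticeToPeriodicBridgePositiveTransfer
import Literature.MathematicalPhysics.QuantumManyBody.BoseGasDirichletWall

/-!
# Route `BECStronglyRayleigh`, crux `LatticeToPeriodicBridge` (stmt-AtomisticToContinuum-9674),
# line `muffin-tin-reward-supermodularity` — stub S4 `stub_freeEndRigidity`

Stub file of the crux line `muffin-tin-reward-supermodularity` (skeleton
`Summits/AtomisticToContinuum/BoseEinsteinCondensation/Cruxes/LatticeToPeriodicBridge/Lines/muffin-tin-reward-supermodularity.lean`),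
landed `--supports stmt-AtomisticToContinuum-9674`: it proves the registered signature `Sig.stub_freeEndRigidity`
of the line's `Defs` module (`Theorems/BECStronglyRayleighLatticeToPeriodicBridgeMuffinTinDefs.lean`) BY NAME, in
the skeleton's namespace.

**Statement (S4, free-end rigidity of the constant-mode occupation).** Taking the fixed-`N` route item
`PeriodicRigidity` (stmt-AtomisticToContinuum-9467, namespace `BECLiebAntibunching`) BY NAME as antecedent: for
every repulsive finite-range `v` there is `ρ₂ > 0` such that for `0 < ρ < ρ₂` and every `ε > 0`, eventually in
`N`, at some slack `δ > 0` any two `δ`-near-minimisers `Ψ, Φ` of the periodic energy on the torus of side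
`L_N = (N/ρ)^{1/3}` have `n₀(Ψ) ≤ n₀(Φ) + εN`.

**Proof.** `ρ₂ := ρ₀`, the threshold of `PeriodicRigidity`. Fix `ρ, ε`, put `η := (ε/2)²` (so `2√η = ε`) and
work at an `N ≥ 1` in the eventual range of rigidity at tolerance `η` (slack `δ`). For two `δ`-near-minimisers
`Ψ, Φ`, rigidity gives a unit `c` with `∫_{Λ^N}|Ψ - cΦ|² ≤ η`; the occupation-transfer lemma
`CoarseCellLorentzian.PositiveTransfer.condensateOccupation_le_add_of_unit_mul_lintegral_le` (phase invariance of
`n₀` and its `L²`-Lipschitz bound on the unit ball, LSSY 2005 App. A (A.11)/(A.13)) gives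
`n₀(Ψ) ≤ n₀(Φ) + 2N√η = n₀(Φ) + εN`.

References: LSSY2005 §1.2, App. A (A.11), (A.13); Fournais2020 (1.1)–(1.5); ReedSimonIV1978 XIII.12/47.
-/

noncomputable section

namespace Summit.AtomisticToContinuum.BoseEinsteinCondensation.Cruxes.LatticeToPeriodicBridge.MuffinTinRewardSupermodularity

open MeasureTheory Filter
open scoped ENNReal NNReal Topology
open Literature.MathematicalPhysics.QuantumManyBody.BoseGas
open Summit.AtomisticToContinuum.BoseEinsteinCondensation.Theses
open Summit.AtomisticToContinuum.BoseEinsteinCondensation.Theses.BECStronglyRayleigh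

/-! ## Bookkeeping -/

namespace FreeEndRigidity

/-- `2N·√((ε/2)²) = εN` for `ε ≥ 0`. [folklore] -/
theorem two_mul_mul_sqrt_sq_half (N : ℕ) {ε : ℝ} (hε : 0 ≤ ε) :
    2 * (N : ℝ) * Real.sqrt ((ε / 2) ^ 2) = ε * N := by
  rw [Real.sqrt_sq (by positivity)]
  ring

end FreeEndRigidity

/-! ## The stub -/

/-- **S4 — free-end rigidity** (stub `stub_freeEndRigidity` of line `muffin-tin-reward-supermodularity`, crux
stmt-AtomisticToContinuum-9674): given `PeriodicRigidity` (stmt-9467) by name, for every admissible `v` there is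
`ρ₂ > 0` (the rigidity threshold) such that for `0 < ρ < ρ₂` and every `ε > 0`, eventually in `N`, at some slack
`δ > 0` the constant-mode occupations of any two `δ`-near-minimisers of the periodic energy on the torus of side
`L_N` agree up to `εN`: rigidity at tolerance `η = (ε/2)²` (fixed before `N`) and the `L²`-Lipschitz occupation
transfer `n₀(Ψ) ≤ n₀(Φ) + 2N√η`. [folklore] -/
theorem stub_freeEndRigidity : Sig.stub_freeEndRigidity := by
  intro hR v hv
  obtain ⟨ρ₀, hρ₀, hrig⟩ := hR v hv
  refine ⟨ρ₀, hρ₀, fun ρ hρ hρlt ε hε => ?_⟩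
  have hη : (0 : ℝ) < (ε / 2) ^ 2 := by positivity
  filter_upwards [hrig ρ hρ hρlt _ hη, eventually_gt_atTop 0] with N hRN hN
  obtain ⟨δ, hδ, hRN⟩ := hRN
  refine ⟨δ, hδ, fun Ψ Φ hΨ hΦ => ?_⟩
  obtain ⟨c, hc, hdist⟩ := hRN Ψ Φ hΨ hΦ
  have hL : 0 < sideLength ρ N := sideLength_pos_of_pos hρ hN
  have hlip :=
    CoarseCellLorentzian.PositiveTransfer.condensateOccupation_le_add_of_unit_mul_lintegral_le hL Ψ Φ hc
      hη.le hdist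
  rwa [FreeEndRigidity.two_mul_mul_sqrt_sq_half N hε.le] at hlip

end Summit.AtomisticToContinuum.BoseEinsteinCondensation.Cruxes.LatticeToPeriodicBridge.MuffinTinRewardSupermodularity

end
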